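import Mathlib.Analysis.Calculus.InverseFunctionTheorem.Analytic
import Mathlib.Analysis.SpecialFunctions.Complex.Analytic
import Mathlib.Analysis.Complex.Polynomial.Basic
import Mathlib.Analysis.Analytic.IsolatedZeros
import HarnessLib

/-!
# Analytic roots, factoring out the value at `0`, and local analytic inverses (one variable)

Topic `Literature/Analysis/Complex` (namespace `Literature.Analysis.Complex.LocalUniformizer`).
Elementary local tools for germs of analytic functions of one complex variable, PROVED, no
definition:

* `exists_analytic_pow_eq` — a germ `V` analytic at `0` with `V(0) ≠ 0` has an analytic `e`-th
  root `w`, `w^e = V` near `0` (`w = α · exp(log(V/V(0))/e)`, `αᵉ = V(0)`);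
* `exists_eq_mul_of_analyticAt` — `f(t) = f(0) + t · u(t)` with `u` analytic, `u(0) = f′(0)`
  (`u = dslope f 0`);
* `exists_local_inverse` — an analytic germ with non-vanishing derivative has an analytic local
  inverse (Mathlib's `AnalyticAt.analyticAt_localInverse`, packaged with the two-sided inverse
  identities near the points);
* `exists_uniformizer` — the LOCAL UNIFORMIZER of a meromorphic germ with a pole: for `V`
  analytic at `0`, `V(0) ≠ 0`, `e ≥ 1`, there are mutually inverse analytic germs `σ, τ` fixing
  `0` with `σ(t)⁻ᵉ = t⁻ᵉ V(t)` near `0`; in the new coordinate `s = σ(t)` the function `t⁻ᵉ V(t)`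
  is exactly `s⁻ᵉ`.

[folklore]

## References

* R. Remmert, *Theory of Complex Functions*, GTM 122, Springer 1991, Ch. 9 §1 (existence of
  holomorphic roots and logarithms on discs), Ch. 9 §4 (local normal form `f = (z h(z))ᵉ`,
  biholomorphy criterion). [folklore]
-/

noncomputable section

open Complex Filter Topology Set Metric

namespace Literature.Analysis.Complex

namespace LocalUniformizer

/-- **Analytic `e`-th roots.** A germ `V` analytic at `0` with `V 0 ≠ 0` has, for every `e ≥ 1`,
an analytic `e`-th root near `0`: `w` analytic at `0`, `w 0 ≠ 0`, `w t ^ e = V t` near `0`.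
[folklore] -/
theorem exists_analytic_pow_eq {V : ℂ → ℂ} (hV : AnalyticAt ℂ V 0) (hV0 : V 0 ≠ 0) {e : ℕ}
    (he : 0 < e) :
    ∃ w : ℂ → ℂ, AnalyticAt ℂ w 0 ∧ w 0 ≠ 0 ∧ ∀ᶠ t in 𝓝 (0 : ℂ), w t ^ e = V t := by
  obtain ⟨α, hα⟩ := IsAlgClosed.exists_pow_nat_eq (V 0) he
  have hα0 : α ≠ 0 := by rintro rfl; rw [zero_pow he.ne'] at hα; exact hV0 hα.symm
  set w : ℂ → ℂ := fun t => α * exp (log (V t * (V 0)⁻¹) / e) with hw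
  have hq : AnalyticAt ℂ (fun t => V t * (V 0)⁻¹) 0 := hV.mul analyticAt_const
  have hq1 : V 0 * (V 0)⁻¹ = 1 := mul_inv_cancel₀ hV0
  have hlog : AnalyticAt ℂ (fun t => log (V t * (V 0)⁻¹)) 0 :=
    hq.clog (by rw [hq1]; exact one_mem_slitPlane)
  have hwan : AnalyticAt ℂ w 0 :=
    analyticAt_const.mul (analyticAt_cexp.comp (hlog.div analyticAt_const (by exact_mod_cast he.ne')))
  refine ⟨w, hwan, ?_, ?_⟩
  · simp only [hw, hq1, Complex.log_one, zero_div, Complex.exp_zero, mul_one]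
    exact hα0
  · have hne : ∀ᶠ t in 𝓝 (0 : ℂ), V t ≠ 0 := hV.continuousAt.eventually_ne hV0
    filter_upwards [hne] with t ht
    have hne' : V t * (V 0)⁻¹ ≠ 0 := mul_ne_zero ht (inv_ne_zero hV0)
    simp only [hw]
    rw [mul_pow, ← Complex.exp_nat_mul, mul_div_cancel₀ _ (by exact_mod_cast he.ne'),
      Complex.exp_log hne', hα]
    field_simp

/-- **Factoring out the value at `0`.** `f t = f 0 + t · u t` with `u` analytic at `0` and
`u 0 = deriv f 0` (the function `u = dslope f 0`). [folklore] -/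
theorem exists_eq_add_mul_of_analyticAt {f : ℂ → ℂ} (hf : AnalyticAt ℂ f 0) :
    ∃ u : ℂ → ℂ, AnalyticAt ℂ u 0 ∧ u 0 = deriv f 0 ∧ ∀ t, f t = f 0 + t * u t := by
  obtain ⟨p, hp⟩ := hf
  refine ⟨dslope f 0, (hp.has_fpower_series_dslope_fslope).analyticAt, dslope_same f 0, fun t => ?_⟩
  have h := sub_smul_dslope f 0 t
  rw [sub_zero, smul_eq_mul] at h
  rw [h]; ring

/-- **Local analytic inverse.** An analytic germ `σ` at `a` with `σ′(a) ≠ 0` has a local inverse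
`τ`, analytic at `σ a`, with `τ (σ a) = a`, `σ ∘ τ = id` near `σ a` and `τ ∘ σ = id` near `a`.
[folklore] -/
theorem exists_local_inverse {σ : ℂ → ℂ} {a : ℂ} (hσ : AnalyticAt ℂ σ a) (hσ' : deriv σ a ≠ 0) :
    ∃ τ : ℂ → ℂ, AnalyticAt ℂ τ (σ a) ∧ τ (σ a) = a ∧
      (∀ᶠ s in 𝓝 (σ a), σ (τ s) = s) ∧ (∀ᶠ t in 𝓝 a, τ (σ t) = t) := by
  refine ⟨hσ.hasStrictDerivAt.localInverse σ (deriv σ a) a hσ', hσ.analyticAt_localInverse hσ',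
    ?_, HasStrictDerivAt.eventually_right_inverse .., HasStrictDerivAt.eventually_left_inverse ..⟩
  exact HasStrictFDerivAt.localInverse_apply_image ..

/-- **Local uniformizer.** For `V` analytic at `0` with `V 0 ≠ 0` and `e ≥ 1` there are germs
`σ, τ` analytic at `0`, inverse to each other near `0`, with `σ 0 = τ 0 = 0`, of the form
`σ t = t · w t`, `τ s = s · u s` with `w, u` analytic and non-vanishing at `0`, such that
`(σ t)ᵉ · V t = tᵉ` near `0` — i.e. `t⁻ᵉ V(t) = σ(t)⁻ᵉ`: `s = σ(t)` is the coordinate in which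
the germ `t⁻ᵉ V(t)` (pole of order `e`) becomes `s⁻ᵉ`. [folklore] -/
theorem exists_uniformizer {V : ℂ → ℂ} (hV : AnalyticAt ℂ V 0) (hV0 : V 0 ≠ 0) {e : ℕ}
    (he : 0 < e) :
    ∃ σ τ w u : ℂ → ℂ, AnalyticAt ℂ σ 0 ∧ AnalyticAt ℂ τ 0 ∧ AnalyticAt ℂ w 0 ∧ AnalyticAt ℂ u 0 ∧
      w 0 ≠ 0 ∧ u 0 ≠ 0 ∧ (∀ t, σ t = t * w t) ∧ (∀ s, τ s = s * u s) ∧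
      (∀ᶠ s in 𝓝 (0 : ℂ), σ (τ s) = s) ∧ (∀ᶠ t in 𝓝 (0 : ℂ), τ (σ t) = t) ∧
      ∀ᶠ t in 𝓝 (0 : ℂ), σ t ^ e * V t = t ^ e := by
  -- `w` = analytic `e`-th root of `V⁻¹`
  have hVinv : AnalyticAt ℂ (fun t => (V t)⁻¹) 0 := hV.inv hV0
  obtain ⟨w, hw, hw0, hwe⟩ := exists_analytic_pow_eq hVinv (inv_ne_zero hV0) he
  set σ : ℂ → ℂ := fun t => t * w t with hσ
  have hσan : AnalyticAt ℂ σ 0 := analyticAt_id.mul hw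
  have hσ0 : σ 0 = 0 := by simp [hσ]
  have hσ' : deriv σ 0 = w 0 := by
    have h : HasDerivAt σ (1 * w 0 + (0 : ℂ) * deriv w 0) 0 :=
      (hasDerivAt_id (0 : ℂ)).mul hw.differentiableAt.hasDerivAt
    rw [h.deriv]; simp
  obtain ⟨τ, hτan, hτ0, hright, hleft⟩ := exists_local_inverse hσan (by rw [hσ']; exact hw0)
  rw [hσ0] at hτan hτ0 hright
  obtain ⟨u, hu, hu0, hτu⟩ := exists_eq_add_mul_of_analyticAt hτan
  have hτu' : ∀ s, τ s = s * u s := fun s => by rw [hτu s, hτ0, zero_add]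
  -- `u 0 = τ′(0) = (σ′(0))⁻¹ ≠ 0`
  have hderτ : deriv τ 0 ≠ 0 := by
    have hst := hσan.hasStrictDerivAt.to_local_left_inverse (by rw [hσ']; exact hw0) hleft
    rw [hσ0] at hst
    rw [hst.hasDerivAt.deriv, hσ']
    exact inv_ne_zero hw0
  refine ⟨σ, τ, w, u, hσan, hτan, hw, hu, hw0, by rw [hu0]; exact hderτ, fun t => rfl, hτu',
    hright, hleft, ?_⟩
  filter_upwards [hwe, hV.continuousAt.eventually_ne hV0] with t ht hVt
  simp only [hσ]
  rw [mul_pow, ht, mul_assoc, inv_mul_cancel₀ hVt, mul_one]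

end LocalUniformizer

end Literature.Analysis.Complex

end
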